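import Summits.BirchSwinnertonDyer.BirchSwinnertonDyer.Theorems.AdditiveKolyvaginRoadLagrangianSwitchAtPGeneralBase
import Summits.BirchSwinnertonDyer.BirchSwinnertonDyer.Theorems.AdditiveKolyvaginRoadSplitPlaneCount
import HarnessLib

/-!
# Route `AdditiveKolyvaginRoad`, crux KS′ `LevelKolyvaginSystemsAdditive` (stmt-BirchSwinnertonDyer-21396) ∕ KPA′ (stmt-BirchSwinnertonDyer-21400):
# POITOU–TATE AT A VISIBLE VERTEX — the relaxed∕strict switch `𝓑[𝔭 ↦ ⊤][𝔭' ↦ 0]` of a SELF-DUAL BASE structure `𝓑` with `#H¹_𝓑 = p`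
# visible at both places above `p` has trivial Selmer group
# (cell `pub/bsd-wall`, width seat `bsd-wall-akr-p2x-w4` g5; `--supports stmt-BirchSwinnertonDyer-21396`, helper; E-side glue)

WHY. Step (5) of THE CHAIN of the crux-ideate card `Cruxes/LevelKolyvaginSystemsAdditive/Ideas/pointwise-klingen-seed.md` («S-vis gives `n₀`;
`E(ℚ_p)[p] = 0 ⇒ Sel_{∅,0}(K, E[p])_{n₀} = 0 = Sel_{0,∅}` (Poitou–Tate at a visible core vertex)») and (T4) `BdpSwitchAtBottom` of card
`theta-cycle-seed` are the same statement of arithmetic duality, at the LEVEL-`n₀` structure (toric above `n₀`) resp. at the bottom (`n₀ = ∅`,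
akr-p2x-w4 g4's `ThetaCycleSeed.bdpSwitchAtBottom`): for a Selmer structure `𝓑` on `E[p]` with `#H¹_𝓑(K, E[p]) = p` whose non-zero classes are
VISIBLE (not locally trivial) at two places `𝔭 ≠ 𝔭'`, the structure relaxed at `𝔭` and strict at `𝔭'` has `H¹ = 0` — PROVIDED the jump
`[H¹_{𝓑[𝔭↦⊤]} : H¹_{𝓑[𝔭↦0]}]` is exactly `p`, which is where self-duality of `𝓑` (Poitou–Tate) and the PLANE `#H¹(K_𝔭, E[p]) = p²` enter. akr-p2x-w3
g10's general-base JUMP `LagrangianSwitchAtP.relIndex_update_bot_top_sq_of_base` (base = E's Kummer conditions off a finite set `U`, LAGRANGIAN on `U`)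
makes the bottom proof work verbatim for every such base, in particular for the canonical level structures of this crux (toric = Lagrangian above
the level, `htorIso_toricLocalCondition` + `natCard_galoisCohomology_one_le_mul_natCard_toricLocalCondition`, as used in `…LevelJumpAboveP`).

WHAT (namespace `…Theorems.AdditiveKoly.VisibleVertex`).
* §1 **`selmerGroup_update_top_bot_card_eq_one_of_base`** — `E = W` over ANY number field `K`, `p ≠ 2`, a Weil pairing `e`, a Poitou–Tate family
  `inv` (perfect, sum formula, Selmer complements), a base `𝓑` Kummer off `U` and Lagrangian on `U`, places `𝔭 ≠ 𝔭'` with `#H¹(K_𝔭, E[p]) = p²`,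
  `#H¹_𝓑 = p`, `loc_𝔭` and `loc_{𝔭'}` injective on `H¹_𝓑` ⟹ `#H¹_{𝓑[𝔭↦⊤][𝔭'↦0]} = 1`; `selmerGroup_update_bot_top_card_eq_one_of_base` (the
  mirror `𝓑[𝔭↦0][𝔭'↦⊤]`, plane at `𝔭'`).
* §2 **`selmerGroup_update_top_bot_card_eq_one_of_base_of_locIrr`** — the same for `E ⊗ K` at a ♯ frame (`K` imaginary quadratic, Heegner hypothesis for
  `N_E`, `p ∣ N_E`, `LocIrr W p`; `𝔭 ≠ 𝔭'` the places above `p`) with the Poitou–Tate family DISCHARGED (`poitouTate_selmerStructure_duality_holds`),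
  the Weil pairing DISCHARGED (`exists_weilPairing_holds`) and the plane DISCHARGED (`SplitPlane.natCard_localH1_eq_sq_of_locIrr_of_heegner`); the
  base enters only through «Kummer off `U`» and «Lagrangian on `U` for every Weil pairing and every perfect family».

HONEST FRAMING: theorems only; 0 definitions, 0 named facts, 0 `sorry`; E-side glue; closes nothing. The specialisation `𝓑 = ` the canonical
level-`n₀` structure (in the route's `SelQP` currency, over S-vis) is NOT done here. BSD is not proved by any of this; KS′/KPA′ stay OPEN at `p² ∣ N`.

References: [cite: MilneADT2006, Ch. I, Cor. 2.3, Thm. 4.10] [cite: Howard2004HeegnerKolyvagin, Thm. 2.1.11] [cite: JetchevSkinnerWan2017, (3.5.d)]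
[cite: PoonenRains2012, Prop. 4.10, Prop. 4.11] [cite: WZhang2014, Lemma 5.3, Prop. 5.4].
-/

-- single-conjunct summit: `Summit.BirchSwinnertonDyer.BirchSwinnertonDyer.…` repeats the name by design
set_option linter.dupNamespace false
set_option autoImplicit false

noncomputable section

open scoped Classical NumberField

namespace Summit.BirchSwinnertonDyer.BirchSwinnertonDyer.Theorems.AdditiveKoly.VisibleVertex

open Function NumberField IsDedekindDomain Field WeierstrassCurve
open Literature.NumberTheory.EllipticCurves Literature.NumberTheory.EllipticCurves.Rank1Residual
open Literature.NumberTheory.GaloisRepresentations Literature.NumberTheory.GaloisRepresentations.DiscreteGaloisModule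
open Literature.NumberTheory.GaloisCohomology
open Summit.BirchSwinnertonDyer.Rank1Residual.X11b.FiniteDuality
open Summit.BirchSwinnertonDyer.Rank1Residual.X11b.Relaxation
open Summit.BirchSwinnertonDyer.Rank1Residual.X11b.LocBridge
open Summit.BirchSwinnertonDyer.Rank1Residual.X11b
open Summit.BirchSwinnertonDyer.Rank1Residual.X11b.KummerPT
open Summit.BirchSwinnertonDyer.Rank1Residual.Additive
open Summit.BirchSwinnertonDyer.BirchSwinnertonDyer.Theorems.SchneiderFreeAdditiveX3.PoitouTateReduction
  (poitouTate_selmerStructure_duality_holds)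
open scoped ContRepresentation

/-! ## §1 The relaxed∕strict switch of a self-dual base at a visible vertex of order `p` -/

section Base

variable {K : Type} [Field K] [NumberField K] (W : WeierstrassCurve K) [W.IsElliptic] (p : ℕ) [Fact p.Prime]
variable (e : W.geomTorsion ((p ^ 1 : ℕ) : ℤ) → W.geomTorsion ((p ^ 1 : ℕ) : ℤ) → AlgebraicClosure K)
  (hμ : ∀ S T, e S T ^ (p ^ 1) = 1)
  (hadd₁ : ∀ S₁ S₂ T, e (S₁ + S₂) T = e S₁ T * e S₂ T)
  (hadd₂ : ∀ S T₁ T₂, e S (T₁ + T₂) = e S T₁ * e S T₂)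
  (hgal : ∀ (σ : absoluteGaloisGroup K) (S T : W.geomTorsion ((p ^ 1 : ℕ) : ℤ)), σ • e S T = e (σ • S) (σ • T))
  (halt : ∀ T, e T T = 1) (hnondeg : ∀ T, (∀ S, e S T = 1) → T = 0)
  (inv : LocalInvariants K (p ^ 1))

include halt hnondeg in
/-- **POITOU–TATE AT A VISIBLE VERTEX (general self-dual base).** `E = W` over a number field `K`, `p ≠ 2`, a Weil pairing `e`, a Poitou–Tate family
`inv`; `𝓑` a Selmer structure on `E[p]` equal to E's Kummer structure off the finite set `U` of finite places and LAGRANGIAN on `U`; two places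
`𝔭 ≠ 𝔭'` with `#H¹(K_𝔭, E[p]) = p²`. If `#H¹_𝓑(K, E[p]) = p` and the localisations at `𝔭` and at `𝔭'` are injective on `H¹_𝓑`, then
`H¹_{𝓑[𝔭↦⊤][𝔭'↦0]}(K, E[p]) = 0`. Proof: `H¹_{𝓑[𝔭↦0]} ≤ H¹_𝓑 ∩ ker loc_𝔭 = 0`; the JUMP `[H¹_{𝓑[𝔭↦⊤]} : H¹_{𝓑[𝔭↦0]}]² = p²`
(`relIndex_update_bot_top_sq_of_base`) gives `#H¹_{𝓑[𝔭↦⊤]} = p = #H¹_𝓑`, so `H¹_{𝓑[𝔭↦⊤]} = H¹_𝓑`; the target is `H¹_{𝓑[𝔭↦⊤]} ∩ ker loc_{𝔭'} =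
H¹_𝓑 ∩ ker loc_{𝔭'} = 0`. (`U = ∅`: `ThetaCycleSeed.bdpSwitchAtBottom`.) [cite: MilneADT2006, Ch. I, Thm. 4.10] [cite: Howard2004HeegnerKolyvagin, Thm. 2.1.11]
[cite: JetchevSkinnerWan2017, (3.5.d)] -/
theorem selmerGroup_update_top_bot_card_eq_one_of_base
    [∀ v : Place K, CompactSpace (absoluteGaloisGroup (Place.Completion v))] [Finite (W.geomTorsion ((p ^ 1 : ℕ) : ℤ))]
    (hp2 : p ≠ 2) (hperf : inv.IsPerfect) (hsum : inv.SumLocalTermEqZero) (hcompl : inv.SelmerComplement)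
    (𝓑 : SelmerStructure (W.torsionGaloisModule ((p ^ 1 : ℕ) : ℤ))) (U : Finset (HeightOneSpectrum (𝓞 K)))
    (h𝓑K : ∀ v : Place K, (∀ u ∈ U, v ≠ Sum.inr u) → 𝓑 v = W.kummerSelmerStructure ((p ^ 1 : ℕ) : ℤ) v)
    (h𝓑lag : ∀ u ∈ U, annRight (invWeilPairing W (p ^ 1) e hμ hadd₁ hadd₂ hgal inv (Sum.inr u)) (𝓑 (Sum.inr u)) =
      𝓑 (Sum.inr u))
    (𝔭 𝔭' : HeightOneSpectrum (𝓞 K)) (hne : 𝔭 ≠ 𝔭')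
    (h𝔭 : Nat.card (galoisCohomology ((W.torsionGaloisModule ((p ^ 1 : ℕ) : ℤ)).toLocal (Sum.inr 𝔭 : Place K)) 1) = p ^ 2)
    (hSel : Nat.card 𝓑.selmerGroup = p)
    (hinj : ∀ x ∈ 𝓑.selmerGroup,
      galoisCohomology.localization (W.torsionGaloisModule ((p ^ 1 : ℕ) : ℤ)) (Sum.inr 𝔭 : Place K) 1 x = 0 → x = 0)
    (hinj' : ∀ x ∈ 𝓑.selmerGroup,
      galoisCohomology.localization (W.torsionGaloisModule ((p ^ 1 : ℕ) : ℤ)) (Sum.inr 𝔭' : Place K) 1 x = 0 → x = 0) :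
    Nat.card (SelmerStructure.selmerGroup
      (Function.update (Function.update 𝓑 (Sum.inr 𝔭 : Place K) ⊤) (Sum.inr 𝔭' : Place K) ⊥ :
        SelmerStructure (W.torsionGaloisModule ((p ^ 1 : ℕ) : ℤ)))) = 1 := by
  have hp : p.Prime := Fact.out
  set 𝓢 : SelmerStructure (W.torsionGaloisModule ((p ^ 1 : ℕ) : ℤ)) :=
    Function.update 𝓑 (Sum.inr 𝔭 : Place K) (⊥ : AddSubgroup _) with h𝓢
  set 𝓡 : SelmerStructure (W.torsionGaloisModule ((p ^ 1 : ℕ) : ℤ)) :=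
    Function.update 𝓑 (Sum.inr 𝔭 : Place K) ⊤ with h𝓡
  -- `H¹_𝓑 ≤ H¹_𝓡`
  have hSelR : 𝓑.selmerGroup ≤ 𝓡.selmerGroup := fun x hx ↦ by
    rw [SelmerStructure.mem_selmerGroup_iff] at hx ⊢
    intro v
    by_cases hv : v = Sum.inr 𝔭
    · subst hv
      rw [h𝓡, Function.update_self]
      exact AddSubgroup.mem_top _
    · rw [h𝓡, Function.update_of_ne hv]
      exact hx v
  -- `H¹_𝓢 = 0`: it lies in `H¹_𝓑 ∩ ker loc_𝔭`
  have hS₀ : 𝓢.selmerGroup = ⊥ := by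
    rw [eq_bot_iff]
    intro x hx
    have hx' := (SelmerStructure.mem_selmerGroup_iff _ _).mp hx
    have hx𝔭 : galoisCohomology.localization (W.torsionGaloisModule ((p ^ 1 : ℕ) : ℤ)) (Sum.inr 𝔭 : Place K) 1 x = 0 := by
      have h := hx' (Sum.inr 𝔭)
      rw [h𝓢, Function.update_self] at h
      exact (AddSubgroup.mem_bot).mp h
    have hxSel : x ∈ 𝓑.selmerGroup := by
      rw [SelmerStructure.mem_selmerGroup_iff]
      intro v
      by_cases hv : v = Sum.inr 𝔭
      · subst hv
        rw [hx𝔭]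
        exact AddSubgroup.zero_mem _
      · have h := hx' v
        rwa [h𝓢, Function.update_of_ne hv] at h
    exact (AddSubgroup.mem_bot).mpr (hinj x hxSel hx𝔭)
  -- the jump `[H¹_𝓡 : H¹_𝓢]² = #H¹(K_𝔭, E[p]) = p²`, so `#H¹_𝓡 = p`
  have hjump := LagrangianSwitchAtP.relIndex_update_bot_top_sq_of_base W p e hμ hadd₁ hadd₂ hgal halt hnondeg inv hp2 hperf hsum hcompl 𝓑 U
    h𝓑K h𝓑lag 𝔭
  rw [h𝔭] at hjump
  have hidx : 𝓢.selmerGroup.relIndex 𝓡.selmerGroup = p := Nat.pow_left_injective two_ne_zero hjump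
  have hR : Nat.card 𝓡.selmerGroup = p := by
    have h := AddSubgroup.relIndex_bot_left 𝓡.selmerGroup
    rw [← hS₀, hidx] at h
    exact h.symm
  -- `H¹_𝓑 = H¹_𝓡` (inclusion of groups of the same prime order)
  haveI : Finite 𝓡.selmerGroup := Nat.finite_of_card_ne_zero (by rw [hR]; exact hp.ne_zero)
  have hSelEq : 𝓑.selmerGroup = 𝓡.selmerGroup := AddSubgroup.eq_of_le_of_card_ge hSelR (by rw [hR, hSel])
  -- the target group is `H¹_𝓡 ∩ ker loc_{𝔭'}`
  have htarget : SelmerStructure.selmerGroup (Function.update 𝓡 (Sum.inr 𝔭' : Place K) ⊥ :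
      SelmerStructure (W.torsionGaloisModule ((p ^ 1 : ℕ) : ℤ))) =
      𝓡.selmerGroup ⊓
        (galoisCohomology.localization (W.torsionGaloisModule ((p ^ 1 : ℕ) : ℤ)) (Sum.inr 𝔭' : Place K) 1).ker := by
    ext x
    simp only [AddSubgroup.mem_inf, AddMonoidHom.mem_ker, SelmerStructure.mem_selmerGroup_iff]
    constructor
    · intro h
      refine ⟨fun v ↦ ?_, ?_⟩
      · by_cases hv2 : v = Sum.inr 𝔭'
        · subst hv2
          have h' := h (Sum.inr 𝔭')
          rw [Function.update_self] at h'
          rw [(AddSubgroup.mem_bot).mp h']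
          exact AddSubgroup.zero_mem _
        · have h' := h v
          rwa [Function.update_of_ne hv2] at h'
      · have h' := h (Sum.inr 𝔭')
        rw [Function.update_self] at h'
        exact (AddSubgroup.mem_bot).mp h'
    · rintro ⟨hxR, hx0⟩ v
      by_cases hv2 : v = Sum.inr 𝔭'
      · subst hv2
        rw [Function.update_self]
        exact (AddSubgroup.mem_bot).mpr hx0
      · rw [Function.update_of_ne hv2]
        exact hxR v
  -- `H¹_𝓑 ∩ ker loc_{𝔭'} = 0` by injectivity at `𝔭'`
  have hbot : 𝓑.selmerGroup ⊓
      (galoisCohomology.localization (W.torsionGaloisModule ((p ^ 1 : ℕ) : ℤ)) (Sum.inr 𝔭' : Place K) 1).ker = ⊥ := by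
    rw [eq_bot_iff]
    rintro x ⟨hx, hx0⟩
    exact (AddSubgroup.mem_bot).mpr (hinj' x hx hx0)
  have hne' : (Sum.inr 𝔭' : Place K) ≠ Sum.inr 𝔭 := fun h ↦ hne (Sum.inr_injective h).symm
  rw [htarget, ← hSelEq, hbot, AddSubgroup.card_bot]

include halt hnondeg in
/-- **The mirror switch `𝓑[𝔭 ↦ 0][𝔭' ↦ ⊤]`** (strict at `𝔭`, relaxed at `𝔭'`; the plane is needed at `𝔭'`): same conclusion — the card's
«`Sel_{∅,0} = 0 = Sel_{0,∅}`». [cite: MilneADT2006, Ch. I, Thm. 4.10] [cite: JetchevSkinnerWan2017, (3.5.d)] -/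
theorem selmerGroup_update_bot_top_card_eq_one_of_base
    [∀ v : Place K, CompactSpace (absoluteGaloisGroup (Place.Completion v))] [Finite (W.geomTorsion ((p ^ 1 : ℕ) : ℤ))]
    (hp2 : p ≠ 2) (hperf : inv.IsPerfect) (hsum : inv.SumLocalTermEqZero) (hcompl : inv.SelmerComplement)
    (𝓑 : SelmerStructure (W.torsionGaloisModule ((p ^ 1 : ℕ) : ℤ))) (U : Finset (HeightOneSpectrum (𝓞 K)))
    (h𝓑K : ∀ v : Place K, (∀ u ∈ U, v ≠ Sum.inr u) → 𝓑 v = W.kummerSelmerStructure ((p ^ 1 : ℕ) : ℤ) v)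
    (h𝓑lag : ∀ u ∈ U, annRight (invWeilPairing W (p ^ 1) e hμ hadd₁ hadd₂ hgal inv (Sum.inr u)) (𝓑 (Sum.inr u)) =
      𝓑 (Sum.inr u))
    (𝔭 𝔭' : HeightOneSpectrum (𝓞 K)) (hne : 𝔭 ≠ 𝔭')
    (h𝔭' : Nat.card (galoisCohomology ((W.torsionGaloisModule ((p ^ 1 : ℕ) : ℤ)).toLocal (Sum.inr 𝔭' : Place K)) 1) = p ^ 2)
    (hSel : Nat.card 𝓑.selmerGroup = p)
    (hinj : ∀ x ∈ 𝓑.selmerGroup,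
      galoisCohomology.localization (W.torsionGaloisModule ((p ^ 1 : ℕ) : ℤ)) (Sum.inr 𝔭 : Place K) 1 x = 0 → x = 0)
    (hinj' : ∀ x ∈ 𝓑.selmerGroup,
      galoisCohomology.localization (W.torsionGaloisModule ((p ^ 1 : ℕ) : ℤ)) (Sum.inr 𝔭' : Place K) 1 x = 0 → x = 0) :
    Nat.card (SelmerStructure.selmerGroup
      (Function.update (Function.update 𝓑 (Sum.inr 𝔭 : Place K) ⊥) (Sum.inr 𝔭' : Place K) ⊤ :
        SelmerStructure (W.torsionGaloisModule ((p ^ 1 : ℕ) : ℤ)))) = 1 := by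
  have hne' : (Sum.inr 𝔭 : Place K) ≠ Sum.inr 𝔭' := fun h ↦ hne (Sum.inr_injective h)
  rw [Function.update_comm hne']
  exact selmerGroup_update_top_bot_card_eq_one_of_base W p e hμ hadd₁ hadd₂ hgal halt hnondeg inv hp2 hperf hsum hcompl 𝓑 U
    h𝓑K h𝓑lag 𝔭' 𝔭 (Ne.symm hne) h𝔭' hSel hinj' hinj

end Base

/-! ## §2 At a ♯ frame on the `LocIrr` locus: Poitou–Tate, the Weil pairing and the plane discharged -/

section Frame

variable (W : WeierstrassCurve ℚ) [W.IsElliptic] [W.IsGloballyMinimal] (K : Type) [Field K] [NumberField K] (p : ℕ) [Fact p.Prime]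
  [∀ v : Place K, CompactSpace (absoluteGaloisGroup (Place.Completion v))]

/-- **POITOU–TATE AT A VISIBLE VERTEX, ♯-frame form.** `W/ℚ`, `K` imaginary quadratic with the Heegner hypothesis for `N_E`, `p ∣ N_E`, `p ≠ 2`,
`LocIrr W p`, `𝔭 ≠ 𝔭'` places above `p`; `𝓑` a Selmer structure on `E_K[p]` equal to the Kummer structure off `U` and Lagrangian on `U` for EVERY
Weil pairing and EVERY perfect family (the shape the tree proves for the toric conditions at admissible primes and for Kummer conditions);
`#H¹_𝓑 = p` with `loc_𝔭`, `loc_{𝔭'}` injective on it ⟹ `#H¹_{𝓑[𝔭↦⊤][𝔭'↦0]} = 1`. The Poitou–Tate family is the PROVED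
`poitouTate_selmerStructure_duality_holds K`, the Weil pairing is `exists_weilPairing_holds`, the plane is `SplitPlane.natCard_localH1_eq_sq_of_locIrr_of_heegner`.
[cite: MilneADT2006, Ch. I, Thm. 4.10] [cite: Howard2004HeegnerKolyvagin, Thm. 2.1.11] [cite: Mazur1977, Ch. III §5, p. 157] -/
theorem selmerGroup_update_top_bot_card_eq_one_of_base_of_locIrr (hK : IsImaginaryQuadratic K)
    (hH : SatisfiesHeegnerHypothesis (W.conductorNorm ℤ) K) (hpN : p ∣ W.conductorNorm ℤ) (hp2 : p ≠ 2) (hL : LocIrr W p)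
    (𝓑 : SelmerStructure ((W.baseChange K).torsionGaloisModule ((p ^ 1 : ℕ) : ℤ))) (U : Finset (HeightOneSpectrum (𝓞 K)))
    (h𝓑K : ∀ v : Place K, (∀ u ∈ U, v ≠ Sum.inr u) → 𝓑 v = (W.baseChange K).kummerSelmerStructure ((p ^ 1 : ℕ) : ℤ) v)
    (h𝓑lag : ∀ (e : geomTorsion (W.baseChange K) ((p ^ 1 : ℕ) : ℤ) → geomTorsion (W.baseChange K) ((p ^ 1 : ℕ) : ℤ) →
        AlgebraicClosure K)
      (hμ : ∀ S T, e S T ^ (p ^ 1) = 1)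
      (hadd₁ : ∀ S₁ S₂ T, e (S₁ + S₂) T = e S₁ T * e S₂ T)
      (hadd₂ : ∀ S T₁ T₂, e S (T₁ + T₂) = e S T₁ * e S T₂)
      (hgal : ∀ (σ : absoluteGaloisGroup K) (S T : geomTorsion (W.baseChange K) ((p ^ 1 : ℕ) : ℤ)),
        σ • e S T = e (σ • S) (σ • T)),
      (∀ T, e T T = 1) → (∀ T, (∀ S, e S T = 1) → T = 0) →
      ∀ inv : LocalInvariants K (p ^ 1), inv.IsPerfect →
      ∀ u ∈ U, annRight (invWeilPairing (W.baseChange K) (p ^ 1) e hμ hadd₁ hadd₂ hgal inv (Sum.inr u)) (𝓑 (Sum.inr u)) =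
        𝓑 (Sum.inr u))
    (𝔭 𝔭' : HeightOneSpectrum (𝓞 K)) (hne : 𝔭 ≠ 𝔭')
    (h𝔭 : ((p : ℕ) : 𝓞 K) ∈ 𝔭.asIdeal)
    (hSel : Nat.card 𝓑.selmerGroup = p)
    (hinj : ∀ x ∈ 𝓑.selmerGroup,
      galoisCohomology.localization ((W.baseChange K).torsionGaloisModule ((p ^ 1 : ℕ) : ℤ)) (Sum.inr 𝔭 : Place K) 1 x = 0 → x = 0)
    (hinj' : ∀ x ∈ 𝓑.selmerGroup,
      galoisCohomology.localization ((W.baseChange K).torsionGaloisModule ((p ^ 1 : ℕ) : ℤ)) (Sum.inr 𝔭' : Place K) 1 x = 0 → x = 0) :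
    Nat.card (SelmerStructure.selmerGroup
      (Function.update (Function.update 𝓑 (Sum.inr 𝔭 : Place K) ⊤) (Sum.inr 𝔭' : Place K) ⊥ :
        SelmerStructure ((W.baseChange K).torsionGaloisModule ((p ^ 1 : ℕ) : ℤ)))) = 1 := by
  have hp : p.Prime := Fact.out
  haveI : NeZero (p ^ 1 : ℕ) := ⟨pow_ne_zero 1 hp.ne_zero⟩
  haveI : Finite (geomTorsion (W.baseChange K) ((p ^ 1 : ℕ) : ℤ)) := finite_geomTorsion_of_neZero (W.baseChange K) (p ^ 1)
  -- a Weil pairing on `E[p]` and the Poitou–Tate family at level `p`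
  have h2p : 2 ≤ p ^ 1 := by rw [pow_one]; exact hp.two_le
  obtain ⟨e, hμ, hadd₁, hadd₂, halt, hnondeg, hgal⟩ :=
    exists_weilPairing_holds (W.baseChange K) (p ^ 1) h2p (by exact_mod_cast pow_ne_zero 1 hp.ne_zero)
  obtain ⟨inv, hperf, hsum, -, hcompl⟩ := poitouTate_selmerStructure_duality_holds K (p ^ 1)
  exact selmerGroup_update_top_bot_card_eq_one_of_base (W.baseChange K) p e hμ hadd₁ hadd₂ hgal halt hnondeg inv hp2 hperf hsum hcompl
    𝓑 U h𝓑K (h𝓑lag e hμ hadd₁ hadd₂ hgal halt hnondeg inv hperf) 𝔭 𝔭' hne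
    (SplitPlane.natCard_localH1_eq_sq_of_locIrr_of_heegner W p hK hH hpN hL 𝔭 h𝔭) hSel hinj hinj'

end Frame

end Summit.BirchSwinnertonDyer.BirchSwinnertonDyer.Theorems.AdditiveKoly.VisibleVertex

end
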